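import Literature.Probability.Percolation.IsoradialDualProofs
import Literature.Probability.LatticeModels.ProdBernoulliThinning
import Literature.Probability.LatticeModels.IsoradialPercolationProofs
import Literature.Probability.Percolation.StarTriangleIsoradial
import HarnessLib

/-!
# The canonical measure of the dual isoradial graph is the law of the dual configuration

Grimmett–Manolescu (*Bond percolation on isoradial graphs*, PTRF 159 (2014) =
arXiv:1204.0505), §2.2: "Let `e* ∈ E*` be the dual edge crossing the primal edge `e ∈ E`. Then
`θ_{e*} = π - θ_e`, so that `p_e + p_{e*} = 1`. In conclusion, the canonical measure `P_{G*}` is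
dual to the primal measure `P_G`"; and "for `ω ∈ Ω` and `e ∈ E`, let `ω*(e*) = 1 - ω(e)`, so
that `e*` is open in the dual graph `G*` if `e` is closed in the primal graph". For an isoradial
rhombic tiling `emb : RhombicEmbedding G F` (`IsIsoradial`, `IsRhombicTiling`) with dual
embedding `emb.dual` (`Literature.Probability.LatticeModels.IsoradialDual`):

* `RhombicEmbedding.dualConfig ω` — **the dual configuration** `ω*`: the set of dual edges
  `e*` whose primal edge `e` is closed, i.e. the edge set of the tree's `dualOpenGraph ω`
  (`openGraph_dualConfig : openGraph (ω*) = dualOpenGraph ω`, so the dual open walks used by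
  the arm events of `IsoradialPercolation` are exactly the open walks of `ω*` in `G*`);
* `dualConfig_eq_thinMap` — `ω ↦ ω*` is the thinning map of
  `Literature.Probability.LatticeModels.ProdBernoulliThinning` along `e* ↦ e`;
* `halfAngle_mem_Ioo`, `edgeWeight_dual` — `p_{e*} = 1 - p_e`
  (`criticalWeight_pi_div_two_sub` of `StarTriangleIsoradial` at the half-angle
  `halfAngle* = π/2 - halfAngle`, `halfAngle_dual`);
* **`isoradialPercolation_map_dualConfig`** — the law of `ω*` under `P_G` is `P_{G*}`, the
  canonical measure of the dual embedding; applied form `isoradialPercolation_real_dualConfig_preimage`.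

## References

* G. R. Grimmett, I. Manolescu, *Bond percolation on isoradial graphs: criticality and
  universality*, PTRF 159 (2014) 273–327, arXiv:1204.0505, §2.2.
* G. Grimmett, *Percolation*, 2nd ed. (1999), §11.2 (planar duality).
-/

noncomputable section

open MeasureTheory Set
open Literature.Probability.LatticeModels Literature.Probability.LatticeModels.RhombicEmbedding

namespace Literature.Probability.LatticeModels.RhombicEmbedding

variable {V F : Type*} {G : SimpleGraph V} (emb : RhombicEmbedding G F)

/-- **The dual configuration** `ω*` of a bond configuration `ω`: the dual edge `{f, g}` is open
iff it crosses a closed primal edge, i.e. `ω*` is the edge set of `dualOpenGraph ω`. A deliberate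
dot-notation extension of the `LatticeModels` structure `RhombicEmbedding`, declared from the
`Percolation` directory like `IsRhombicTiling`. (Grimmett–Manolescu 2014, §2.2: "`ω*(e*) = 1 - ω(e)`";
Grimmett 1999, §11.2.)
[cite: GrimmettManolescu2014Isoradial, §2.2 (the dual configuration ω*)] -/
def dualConfig (ω : Percolation.BondConfig V) : Percolation.BondConfig F :=
  (emb.dualOpenGraph ω).edgeSet

/-- The open graph of the dual configuration is the dual open graph. [folklore] -/
theorem openGraph_dualConfig (ω : Percolation.BondConfig V) :
    Percolation.openGraph (emb.dualConfig ω) = emb.dualOpenGraph ω :=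
  SimpleGraph.fromEdgeSet_edgeSet _

/-- Membership of a pair of faces in the dual configuration. [folklore] -/
theorem mk_mem_dualConfig_iff {ω : Percolation.BondConfig V} {f g : F} :
    s(f, g) ∈ emb.dualConfig ω ↔ (emb.dualOpenGraph ω).Adj f g :=
  SimpleGraph.mem_edgeSet _

/-- The dual configuration consists of dual edges. [folklore] -/
theorem dualConfig_subset_edgeSet (ω : Percolation.BondConfig V) :
    emb.dualConfig ω ⊆ emb.dualGraph.edgeSet :=
  SimpleGraph.edgeSet_mono (emb.dualOpenGraph_le_dualGraph ω)

end Literature.Probability.LatticeModels.RhombicEmbedding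

namespace Literature.Probability.Percolation

variable {V F : Type*} {G : SimpleGraph V} {emb : RhombicEmbedding G F}

/-- The primal edge crossed by a dual edge, as a map on the dual edge set (the inverse of
`edgeEquivDual`, with values in `Sym2 V`). [folklore] -/
theorem edgeEquivDual_symm_coe (hiso : emb.IsIsoradial) (hrh : emb.IsRhombicTiling)
    (z : emb.dualGraph.edgeSet) :
    ((edgeEquivDual hiso hrh).symm z : Sym2 V) = (emb.primalDart (refDart z)).edge := rfl

/-- A dual dart is dual-open iff the primal dart it crosses is closed. [folklore] -/
theorem dualOpenGraph_adj_iff (hiso : emb.IsIsoradial) (hrh : emb.IsRhombicTiling)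
    {ω : BondConfig V} (D : emb.dualGraph.Dart) :
    (emb.dualOpenGraph ω).Adj D.fst D.snd ↔ (emb.primalDart D).edge ∉ ω := by
  rw [RhombicEmbedding.dualOpenGraph, SimpleGraph.fromRel_adj]
  constructor
  · rintro ⟨-, ⟨d, h1, h2, h3⟩ | ⟨d, h1, h2, h3⟩⟩
    · have hd : d = emb.primalDart D := eq_of_leftFace_eq_of_rightFace_eq hiso hrh
        (h1.trans (emb.leftFace_primalDart hiso D).symm)
        (h2.trans (emb.rightFace_primalDart hiso D).symm)
      rwa [← hd]
    · have hd : d = emb.primalDart D.symm := eq_of_leftFace_eq_of_rightFace_eq hiso hrh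
        (h1.trans (emb.leftFace_primalDart hiso D.symm).symm)
        (h2.trans (emb.rightFace_primalDart hiso D.symm).symm)
      rw [primalDart_symm hiso hrh] at hd
      rwa [hd, SimpleGraph.Dart.edge_symm] at h3
  · intro h
    refine ⟨fun hfg => ?_, Or.inl ⟨emb.primalDart D, emb.leftFace_primalDart hiso D,
      emb.rightFace_primalDart hiso D, h⟩⟩
    apply hiso.c_leftFace_ne (emb.primalDart D)
    rw [emb.leftFace_primalDart hiso, emb.rightFace_primalDart hiso, hfg]

/-- **The dual configuration is the thinning of the primal one along `e* ↦ e`**: `ω*` is the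
set of dual edges `e*` with `e ∉ ω` (and contains no non-edge of `G*`). [folklore] -/
theorem dualConfig_eq_thinMap (hiso : emb.IsIsoradial) (hrh : emb.IsRhombicTiling)
    (ω : BondConfig V) :
    emb.dualConfig ω = thinMap (emb.dualGraph.edgeSet)
      (fun z => ((edgeEquivDual hiso hrh).symm z : Sym2 V)) ω := by
  ext z
  rw [mem_thinMap_iff]
  constructor
  · intro hz
    have hzE : z ∈ emb.dualGraph.edgeSet := emb.dualConfig_subset_edgeSet ω hz
    refine ⟨hzE, ?_⟩
    set D : emb.dualGraph.Dart := refDart ⟨z, hzE⟩ with hD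
    have hz' : s(D.fst, D.snd) ∈ emb.dualConfig ω := by
      have : s(D.fst, D.snd) = z := refDart_edge ⟨z, hzE⟩
      rwa [this]
    rw [edgeEquivDual_symm_coe]
    exact (dualOpenGraph_adj_iff hiso hrh D).1 ((emb.mk_mem_dualConfig_iff).1 hz')
  · rintro ⟨hzE, hz⟩
    set D : emb.dualGraph.Dart := refDart ⟨z, hzE⟩ with hD
    rw [edgeEquivDual_symm_coe] at hz
    have : s(D.fst, D.snd) = z := refDart_edge ⟨z, hzE⟩
    rw [← this, emb.mk_mem_dualConfig_iff]
    exact (dualOpenGraph_adj_iff hiso hrh D).2 hz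

/-- The dual configuration map is measurable. [folklore] -/
theorem measurable_rhombicDualConfig (hiso : emb.IsIsoradial) (hrh : emb.IsRhombicTiling) :
    Measurable (emb.dualConfig : BondConfig V → BondConfig F) := by
  have : (emb.dualConfig : BondConfig V → BondConfig F) = thinMap (emb.dualGraph.edgeSet)
      (fun z => ((edgeEquivDual hiso hrh).symm z : Sym2 V)) :=
    funext (dualConfig_eq_thinMap hiso hrh)
  rw [this]
  exact measurable_thinMap _ _

/-! ### `p_{e*} = 1 - p_e` -/

/-- The half-angle of a dart of an isoradial embedding lies strictly between `0` and `π/2`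
(its cosine `‖z x - z y‖ / 2` lies strictly between `0` and `1`: the edge is a diagonal of a
non-degenerate rhombus with unit sides). [folklore] -/
theorem halfAngle_mem_Ioo (hiso : emb.IsIsoradial) (d : G.Dart) :
    emb.halfAngle d ∈ Ioo 0 (Real.pi / 2) := by
  obtain ⟨h0, hpi2⟩ := halfAngle_mem_Icc hiso d
  have hcos := IsoradialCriticality.cos_halfAngle hiso d
  have hlt := IsoradialCriticality.norm_z_sub_z_lt_two hiso d
  have hpos : 0 < ‖emb.z d.fst - emb.z d.snd‖ :=
    norm_pos_iff.2 (sub_ne_zero.2 fun h => d.fst_ne_snd (hiso.z_injective h))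
  refine ⟨lt_of_le_of_ne h0 fun h => ?_, lt_of_le_of_ne hpi2 fun h => ?_⟩
  · rw [← h, Real.cos_zero] at hcos; linarith
  · rw [h, Real.cos_pi_div_two] at hcos; linarith

/-- **`p_{e*} = 1 - p_e`**: the canonical weight of a dual edge is one minus the weight of the
primal edge it crosses (`θ_{e*} = π - θ_e`, Grimmett–Manolescu 2014, §2.2, and the self-duality
`p_θ + p_{π-θ} = 1` of the isoradial weights, tree: `criticalWeight_pi_div_two_sub`).
[cite: GrimmettManolescu2014Isoradial, §2.2 (p_e + p_{e*} = 1)] -/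
theorem edgeWeight_dual (hiso : emb.IsIsoradial) (hrh : emb.IsRhombicTiling) (z : Sym2 F) :
    emb.dual.edgeWeight z = thinParam emb.edgeWeight (emb.dualGraph.edgeSet)
      (fun z => ((edgeEquivDual hiso hrh).symm z : Sym2 V)) z := by
  classical
  by_cases hz : z ∈ emb.dualGraph.edgeSet
  · simp only [thinParam, dif_pos hz]
    set D : emb.dualGraph.Dart := refDart ⟨z, hz⟩ with hD
    have e1 := edgeWeight_eq_of_isIsoradial_holds (emb := emb.dual) (isIsoradial_dual hiso hrh) D
    have hDe : D.edge = z := refDart_edge ⟨z, hz⟩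
    rw [hDe] at e1
    have e2 := edgeWeight_eq_of_isIsoradial_holds (emb := emb) hiso (emb.primalDart D)
    rw [edgeEquivDual_symm_coe, e1, e2, halfAngle_dual hiso hrh]
    apply Subtype.ext
    have hθ := halfAngle_mem_Ioo hiso (emb.primalDart D)
    have hθ' : Real.pi / 2 - emb.halfAngle (emb.primalDart D) ∈ Icc 0 (Real.pi / 2) :=
      ⟨by linarith [hθ.2], by linarith [hθ.1]⟩
    rw [unitInterval.coe_symm_eq, coe_criticalWeightI_holds hθ',
      coe_criticalWeightI_holds ⟨hθ.1.le, hθ.2.le⟩, StarTriangle.criticalWeight_pi_div_two_sub hθ]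
  · simp only [thinParam, dif_neg hz]
    simp [RhombicEmbedding.edgeWeight, hz]

/-- **The law of the dual configuration under `P_G` is `P_{G*}`** (Grimmett–Manolescu 2014,
§2.2: "the canonical measure `P_{G*}` is dual to the primal measure `P_G`"): the image of the
canonical measure of `emb` under `ω ↦ ω*` is the canonical measure of the dual embedding
`emb.dual`. [cite: GrimmettManolescu2014Isoradial, §2.2 (P_{G*} is dual to P_G)] -/
theorem isoradialPercolation_map_dualConfig (hiso : emb.IsIsoradial) (hrh : emb.IsRhombicTiling) :
    emb.isoradialPercolation.map emb.dualConfig = emb.dual.isoradialPercolation := by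
  have h1 : (emb.dualConfig : BondConfig V → BondConfig F) = thinMap (emb.dualGraph.edgeSet)
      (fun z => ((edgeEquivDual hiso hrh).symm z : Sym2 V)) :=
    funext (dualConfig_eq_thinMap hiso hrh)
  have h2 : emb.dual.edgeWeight = thinParam emb.edgeWeight (emb.dualGraph.edgeSet)
      (fun z => ((edgeEquivDual hiso hrh).symm z : Sym2 V)) :=
    funext (edgeWeight_dual hiso hrh)
  change (prodBernoulli emb.edgeWeight).map emb.dualConfig = prodBernoulli emb.dual.edgeWeight
  rw [h1, h2]
  exact prodBernoulli_map_thin fun z z' h =>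
    (edgeEquivDual hiso hrh).symm.injective (Subtype.ext h)

/-- Applied form: the `P_G`-probability that the dual configuration lies in `S` is the
`P_{G*}`-probability of `S`, for every measurable `S`. [cite: GrimmettManolescu2014Isoradial, §2.2 (P_{G*} is dual to P_G)] -/
theorem isoradialPercolation_real_dualConfig_preimage (hiso : emb.IsIsoradial)
    (hrh : emb.IsRhombicTiling) {S : Set (BondConfig F)} (hS : MeasurableSet S) :
    emb.isoradialPercolation.real (emb.dualConfig ⁻¹' S) = emb.dual.isoradialPercolation.real S := by
  rw [measureReal_def, measureReal_def, ← isoradialPercolation_map_dualConfig hiso hrh,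
    Measure.map_apply (measurable_rhombicDualConfig hiso hrh) hS]

end Literature.Probability.Percolation

end
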